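import Summits.ResolutionOfSingularities.ResolutionOfSingularities.Theorems.PurelyInseparableDim4ChartAtlasInsideReading
import Summits.ResolutionOfSingularities.ResolutionOfSingularities.Theorems.PurelyInseparableDim4ChartAtlasPackage
import HarnessLib

/-!
# Purely inseparable four-folds `z^p + F(x₁, …, x₄)`: THE ATLAS OF AN ESCAPING GLOBAL CENTRE INSIDE THE EXCEPTIONAL DIVISOR —
# cover and package on the walk's data (brick S3-N1 «atlas of an escaping global centre», part E7, case `j ∈ S'`; cell
# `res-dim4-pi`, typ-2 g5)

[OURS · counted 0] (D-0157 DOOR 2; DR-157-C; desk WORD #115 (a) (S3-N1); typ-3 g4 `S3c-V3-DESIGN.md` addendum (b) «escaping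
children INSIDE `E_j` (`j ∈ S″`, `S ⊄ S″`): atlas members (several charts), closure admissible = typ-2 g4's Q1/Q2/Q3 with
`j ∈ S'`»; frame `PIDim4.TerminationImpliesOrderReduction`, S3 (c)). ASSEMBLY of E5/E6 with typ-2 g4's depth-2 package
(C1 `globalCentre_admissible_package`, case `j ∈ S'`) on the walk's own data: a presented state `s` (`s.F ≠ 0` clean), a
Hironaka-permissible `S ∋ j`, ANY blowing up `π : W → 𝔸⁵_K` along `V(z, x_S)`, a point `b` of the `x_j`-chart's exceptional
hyperplane (`b_j = 0`), a next centre `S' ∋ j` permissible for `step p S j b s` (inside `E₁`; escaping iff `S ⊄ S'`),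
`S″ = S' ∖ {j}`:

* **`support_globalCentre_subset_iUnion_of_mem`** — `V(Zc) ⊆ ⋃_{l ∈ S ∖ S″} W[⊤, x_l]`: the global centre is covered by the
  `x_j`-chart and the charts `x_l`, `l ∈ S ∖ S'`;
* `exists_shear_chart_reading_of_mem` — ONE CHART: for `l ∈ S ∖ S'` a cleaned shear re-centring `Θ_l` of the `x_l`-chart
  (`z ↦ z + g_l`, base shear `τ_l`) with `φ_l^*(M.transform π).ideal = (z^p + F_l)·𝒪`, **`φ_l^* Zc = 𝓘Λ_{insert l S″}`**,
  `F_l ≠ 0` CLEAN, `p ≤ ord_{(x_{insert l S″})} F_l`, `E₁` reads `x_l`;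
* **`globalCentre_atlas_package_of_mem`** — the whole package: C1's `x_j`-chart conjuncts (`φⱼ` reads `M'` as
  `(z^p + (step p S j b s).F)·𝒪` and `Zc` as `𝓘Λ_{S'}`; `Zc` regular, `⊆ supp M'`, snc with `M'.boundary`) ∧ the cover ∧ one
  chart block per `l ∈ S ∖ S'`;
* **`globalCentre_atlas_package`** — BOTH CASES in one signature (with E4): cover by the charts `l ∈ S ∖ (S' ∖ {j})`, chart `l`
  reading `Zc` as `𝓘Λ_{T_l}`, `T_l = insert l (S' ∖ {j})` if `j ∈ S'` and `T_l = S'` otherwise.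

HONEST SCOPE: `K` algebraically closed of characteristic `p`; depth 2 (boundary `[E₁]`) for the snc conjunct, all other
conjuncts boundary-free; OLDER boundary members under the shear (S3-N2), the walk over the added points `closure ∖ image` and
termination are NOT addressed; resolution of singularities in dimension ≥ 4 / characteristic `p` is NOT proved anywhere in this
programme. bears_on: LADDER-RESOLUTION:D157-DOOR2 (res-dim4-pi). Supports stmt-ResolutionOfSingularities-16155 (helper,
S3-N1 E7).
-/

-- every declaration of this summit lives under `Summit.ResolutionOfSingularities.ResolutionOfSingularities`
-- (summit = problem), which the duplicate-namespace linter flags; house convention (cf. the Target file).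
set_option linter.dupNamespace false

noncomputable section

open MvPolynomial Finset CategoryTheory AlgebraicGeometry Opposite TopologicalSpace
open AlgebraicGeometry.Scheme.IdealSheafData (ofIdealTop vanishingIdeal)

namespace Summit.ResolutionOfSingularities.ResolutionOfSingularities.Theorems.PIDim4

open Literature.AlgebraicGeometry.Resolution
open Literature.AlgebraicGeometry.Resolution.Hauser2010
open Literature.AlgebraicGeometry.Resolution.AffinePointBlowup (P A γ coord Wtop ξ)
open Literature.Barriers.ResolutionOfSingularities

namespace ChartDictionary

variable {K : Type} [Field K] {p : ℕ} [hp : Fact p.Prime] [CharP K p]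
  {S S' : Finset (Fin 4)} {j : Fin 4} {b : Fin 4 → K} {Θⱼ : A 4 K ≃ₐ[K] A 4 K} {h : MvPolynomial (Fin 4) K}
  {F F₁ : MvPolynomial (Fin 4) K} {W : Scheme.{0}} {π : W ⟶ P 4 K}

/-! ## §1 The cover for a next centre inside `E₁` -/

/-- **`V(Zc) ⊆ ⋃_{l ∈ S ∖ S″} W[⊤, x_l]`** (`j ∈ S'`, `S″ = S' ∖ {j}`): every point of the global centre lies in the support of
the transform, hence in some `xᵢ`-chart, `i ∈ S` (`…ChartCover`); the charts `i ∈ S″` are absorbed by the `x_j`-chart (E3: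
`1 − bᵢ x_j` lies in the strict transform of the graph `Y″` there, and `V(Zc) ⊆ V(St_π(𝒥″))`). -/
theorem support_globalCentre_subset_iUnion_of_mem [PerfectField K] (hj : j ∈ S) (hjS' : j ∈ S') (hbj : b j = 0)
    (h0j : Θⱼ (X 0) = X 0 + rename Fin.succ h) (hsj : ∀ i : Fin 4, Θⱼ (X i.succ) = X i.succ + C (b i))
    (hπ : IsBlowup π (AffineCoordBlowup.𝓘Λ 4 K (insert 0 (Fin.succ '' (S : Set (Fin 4))))))
    (hperm : (p : ℕ∞) ≤ CentreBlowup.ordAlong S F)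
    (hread : Θⱼ (coordBlowupSubst K (insert 0 (Fin.succ '' (S : Set (Fin 4)))) j.succ (hyp p F)) =
      X j.succ ^ p * hyp p F₁)
    (hperm' : (p : ℕ∞) ≤ CentreBlowup.ordAlong S' F₁) :
    haveI : IsIso (CommRingCat.ofHom (Θⱼ : A 4 K →+* A 4 K)) :=
      (inferInstance : IsIso Θⱼ.toRingEquiv.toCommRingCatIso.hom)
    ((vanishingIdeal (closureImage
        (Spec.map (CommRingCat.ofHom (Θⱼ : A 4 K →+* A 4 K)) ≫ AffineCoordBlowup.chartImm hπ (succ_mem_centreVars hj))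
        ((AffineCoordBlowup.𝓘Λ 4 K (insert 0 (Fin.succ '' (S' : Set (Fin 4))))).support : Set (P 4 K)))).support :
          Set W) ⊆
      ⋃ (l : Fin 4) (hl : l ∈ S \ S'.erase j),
        ((AffineCoordBlowup.chartImm hπ (succ_mem_centreVars (Finset.mem_sdiff.mp hl).1)).opensRange : Set W) := by
  haveI : IsIso (CommRingCat.ofHom (Θⱼ : A 4 K →+* A 4 K)) :=
    (inferInstance : IsIso Θⱼ.toRingEquiv.toCommRingCatIso.hom)
  haveI : IsProper π := hπ.isProper
  haveI : IsLocallyNoetherian W := LocallyOfFiniteType.isLocallyNoetherian π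
  haveI : CompactSpace W := QuasiCompact.compactSpace_of_compactSpace π
  haveI : IsNoetherian W := ⟨⟩
  have hp0 : p ≠ 0 := hp.out.ne_zero
  have hjS'' : j ∉ S'.erase j := Finset.notMem_erase j S'
  obtain ⟨H, hH⟩ := exists_lift_twist hj hbj h0j hsj hperm hread hperm'
  have hpiece := closureImage_mem_boundaryPieces hj hjS' hbj h0j hsj hπ hH
  rw [Kollar2007.mem_boundaryPieces_iff] at hpiece
  have hsub := (mem_componentsIn_iff.mp hpiece).1
  have hsupp := support_globalCentre_subset_support_transform hj hbj h0j hsj hπ hperm hread hperm'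
  intro w hw
  obtain ⟨i, hi, hwi⟩ := Set.mem_iUnion₂.mp (support_transform_subset_iUnion hp0 F hperm [] hπ (hsupp hw))
  by_cases hiS'' : i ∈ S'.erase j
  · -- absorbed by the `x_j`-chart
    rw [Scheme.IdealSheafData.coe_support_vanishingIdeal] at hw
    have hw' := Scheme.IdealSheafData.support_antitone le_sup_left (hsub hw)
    have hwj := support_strictTransformIdeal_graph_inter_opensRange_subset hj hjS'' (Finset.mem_inter.mpr ⟨hiS'', hi⟩) hπ H
      ⟨hw', hwi⟩
    exact Set.mem_iUnion₂.mpr ⟨j, Finset.mem_sdiff.mpr ⟨hj, hjS''⟩, hwj⟩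
  · exact Set.mem_iUnion₂.mpr ⟨i, Finset.mem_sdiff.mpr ⟨hi, hiS''⟩, hwi⟩

/-! ## §2 One chart of the atlas (`j ∈ S'`) -/

/-- **One chart of the atlas, `j ∈ S'`.** For `l ∈ S ∖ S'` there is a CLEANED shear re-centring of the `x_l`-chart reading
`Zc` as `𝓘Λ_{insert l S″}` and the transform as a clean, permissible, non-zero `z^p + F_l`. -/
theorem exists_shear_chart_reading_of_mem [IsAlgClosed K] (hj : j ∈ S) (hjS' : j ∈ S') (hbj : b j = 0)
    (hF : F ≠ 0) (hclean : HauserPerlega.IsClean p F)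
    (h0j : Θⱼ (X 0) = X 0 + rename Fin.succ h) (hsj : ∀ i : Fin 4, Θⱼ (X i.succ) = X i.succ + C (b i))
    (hπ : IsBlowup π (AffineCoordBlowup.𝓘Λ 4 K (insert 0 (Fin.succ '' (S : Set (Fin 4))))))
    (hperm : (p : ℕ∞) ≤ CentreBlowup.ordAlong S F)
    (hread : Θⱼ (coordBlowupSubst K (insert 0 (Fin.succ '' (S : Set (Fin 4)))) j.succ (hyp p F)) =
      X j.succ ^ p * hyp p F₁)
    (hperm' : (p : ℕ∞) ≤ CentreBlowup.ordAlong S' F₁) {l : Fin 4} (hl : l ∈ S) (hlS' : l ∉ S') :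
    haveI : IsIso (CommRingCat.ofHom (Θⱼ : A 4 K →+* A 4 K)) :=
      (inferInstance : IsIso Θⱼ.toRingEquiv.toCommRingCatIso.hom)
    ∃ (Θ : A 4 K ≃ₐ[K] A 4 K) (τ : MvPolynomial (Fin 4) K ≃ₐ[K] MvPolynomial (Fin 4) K) (g : MvPolynomial (Fin 4) K)
      (_ : IsIso (CommRingCat.ofHom (Θ : A 4 K →+* A 4 K))),
      Θ (X 0) = X 0 + rename Fin.succ g ∧ (∀ i : Fin 4, Θ (X i.succ) = rename Fin.succ (τ (X i))) ∧
      τ (X j) = X j ∧ τ (X l) = X l ∧ (∀ i ∈ S, i ≠ j → i ≠ l → τ (X i) = X i + C (b i) * X j) ∧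
      (∀ k ∉ S, τ (X k) = X k + C (b k)) ∧
      let φ := Spec.map (CommRingCat.ofHom (Θ : A 4 K →+* A 4 K)) ≫ AffineCoordBlowup.chartImm hπ (succ_mem_centreVars hl)
      let Zc := vanishingIdeal (closureImage
        (Spec.map (CommRingCat.ofHom (Θⱼ : A 4 K →+* A 4 K)) ≫ AffineCoordBlowup.chartImm hπ (succ_mem_centreVars hj))
        ((AffineCoordBlowup.𝓘Λ 4 K (insert 0 (Fin.succ '' (S' : Set (Fin 4))))).support : Set (P 4 K)))
      let M' := ((⟨hypSheaf p F, [], p⟩ : MarkedIdeal (P 4 K)).transform π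
        (AffineCoordBlowup.𝓘Λ 4 K (insert 0 (Fin.succ '' (S : Set (Fin 4))))))
      let Fl := g ^ p + τ (CentreBlowup.chartTransform p S l F)
      M'.ideal.comap φ = hypSheaf p Fl ∧
      Zc.comap φ = AffineCoordBlowup.𝓘Λ 4 K (insert 0 (Fin.succ '' ((insert l (S'.erase j) : Finset (Fin 4)) : Set (Fin 4)))) ∧
      Fl ≠ 0 ∧ HauserPerlega.IsClean p Fl ∧ (p : ℕ∞) ≤ CentreBlowup.ordAlong (insert l (S'.erase j)) Fl ∧
      ((AffineCoordBlowup.𝓘Λ 4 K (insert 0 (Fin.succ '' (S : Set (Fin 4))))).comap π).comap φ =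
        ofIdealTop (Ideal.span {(γ 4 K).symm (X l.succ + C 0)}) := by
  haveI : IsIso (CommRingCat.ofHom (Θⱼ : A 4 K →+* A 4 K)) :=
    (inferInstance : IsIso Θⱼ.toRingEquiv.toCommRingCatIso.hom)
  haveI : PerfectRing K p := PerfectRing.ofSurjective K p fun x => IsAlgClosed.exists_pow_nat_eq x hp.out.pos
  have hjl : j ≠ l := fun e => hlS' (e ▸ hjS')
  -- the lift `H` of the `x_j`-chart and its `x_l`-chart quotient `H_l`
  obtain ⟨H, hH⟩ := exists_lift_twist hj hbj h0j hsj hperm hread hperm'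
  obtain ⟨Hl, hHl⟩ := exists_coordBlowupSubst_eq_X_mul_of_mem_span hl (mem_span_X_of_lift hj hH)
  -- the base shear and the RAW re-centring `Ξ` (`z ↦ z + τ H_l`)
  obtain ⟨τ, hτj, hτl, hτS, hτb⟩ := exists_algEquiv_shearBase hj hl b
  have hτ1 : ∀ i ∈ S'.erase j ∩ S, τ (X i) = X i + C (b i) * X j := fun i hi => by
    obtain ⟨hiS', hiS⟩ := Finset.mem_inter.mp hi
    exact hτS i hiS (Finset.ne_of_mem_erase hiS') (fun e => hlS' (e ▸ Finset.mem_of_mem_erase hiS'))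
  have hτ2 : ∀ k ∈ S'.erase j \ S, τ (X k) = X k + C (b k) := fun k hk => hτb k (Finset.mem_sdiff.mp hk).2
  obtain ⟨Ξ, hΞ0, hΞτ⟩ := exists_algEquiv_shear_lift (K := K) τ (τ Hl)
  -- raw permissibility (trivial cleaning `θ₀`, root `0`), then clean keeping the centre `V(z, x_{insert l S″})`
  obtain ⟨θ₀, hθ₀0, hθ₀s⟩ := exists_algEquiv_clean (K := K) (0 : MvPolynomial (Fin 4) K)
  have h0mem : (0 : MvPolynomial (Fin 4) K) ∈
      Ideal.span (X '' ((insert l (S'.erase j) : Finset (Fin 4)) : Set (Fin 4)) : Set (MvPolynomial (Fin 4) K)) :=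
    Ideal.zero_mem _
  have hperm₀ := le_ordAlong_shear_reading_of_mem hj hjS' hbj h0j hsj hπ hperm hread hperm' hH hl hlS' hΞ0 hΞτ hτl hτj hτ1 hτ2
    hHl hθ₀0 hθ₀s h0mem
  have hg₀ : τ Hl + 0 - τ Hl ∈
      Ideal.span (X '' ((insert l (S'.erase j) : Finset (Fin 4)) : Set (Fin 4)) : Set (MvPolynomial (Fin 4) K)) := by
    rw [add_zero, sub_self]; exact Ideal.zero_mem _
  obtain ⟨g, hg, hgeq, hgclean, -⟩ := exists_clean_shear_root (S' := insert l (S'.erase j)) (τ Hl + 0)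
    (τ (CentreBlowup.chartTransform p S l F)) (τ Hl) hg₀ hperm₀
  -- the cleaned re-centring `Θ = Ξ.trans θ`, `θ z = z + (g − τ H_l)`
  obtain ⟨θ, hθ0, hθs⟩ := exists_algEquiv_clean (K := K) (g - τ Hl)
  have hgδ : τ Hl + (g - τ Hl) = g := by ring
  have h0 : (Ξ.trans θ) (X 0) = X 0 + rename Fin.succ g := by rw [trans_clean_X_zero hΞ0 hθ0 hθs, hgδ]
  have hτΘ : ∀ i : Fin 4, (Ξ.trans θ) (X i.succ) = rename Fin.succ (τ (X i)) := trans_clean_X_succ hΞτ hθs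
  haveI hiso : IsIso (CommRingCat.ofHom ((Ξ.trans θ : A 4 K ≃ₐ[K] A 4 K) : A 4 K →+* A 4 K)) :=
    (inferInstance : IsIso (Ξ.trans θ).toRingEquiv.toCommRingCatIso.hom)
  refine ⟨Ξ.trans θ, τ, g, hiso, h0, hτΘ, hτj, hτl, hτS, hτb, ?_, ?_, ?_, hgclean, ?_, ?_⟩
  · exact comap_shear_chart_transform_ideal hl h0 hτΘ hπ hperm _ rfl rfl
  · exact comap_shear_chart_globalCentre_of_mem hj hjS' hbj h0j hsj hπ hH hl hlS' hΞ0 hΞτ hτl hτj hτ1 hτ2 hHl hθ0 hθs hg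
  · rw [hgeq]
    exact deletePthPowers_shear_reading_ne_zero hl hF hclean hperm τ (τ Hl + 0)
  · have h1 := le_ordAlong_shear_reading_of_mem hj hjS' hbj h0j hsj hπ hperm hread hperm' hH hl hlS' hΞ0 hΞτ hτl hτj hτ1
      hτ2 hHl hθ0 hθs hg
    rwa [hgδ] at h1
  · exact comap_shear_chart_exceptional hl hτΘ hτl hπ

/-! ## §3 The package (`j ∈ S'`) -/

/-- **THE ATLAS OF AN ESCAPING GLOBAL CENTRE INSIDE `E₁` (S3-N1, typ-2 side, `j ∈ S'`), on the walk's own data** — see the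
module docstring. -/
theorem globalCentre_atlas_package_of_mem [IsAlgClosed K] [DecidableEq K] (hj : j ∈ S) (hjS' : j ∈ S')
    (hbj : b j = 0) (s : State K) (hF : s.F ≠ 0) (hclean : HauserPerlega.IsClean p s.F)
    (hperm : (p : ℕ∞) ≤ CentreBlowup.ordAlong S s.F)
    (hπ : IsBlowup π (AffineCoordBlowup.𝓘Λ 4 K (insert 0 (Fin.succ '' (S : Set (Fin 4))))))
    (hperm' : (p : ℕ∞) ≤ CentreBlowup.ordAlong S' (CentreBlowup.step p S j b s).F) :
    ∃ (Θⱼ : A 4 K ≃ₐ[K] A 4 K) (h : MvPolynomial (Fin 4) K) (_ : IsIso (CommRingCat.ofHom (Θⱼ : A 4 K →+* A 4 K))),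
      Θⱼ (X 0) = X 0 + rename Fin.succ h ∧ (∀ i : Fin 4, Θⱼ (X i.succ) = X i.succ + C (b i)) ∧
      let φⱼ := Spec.map (CommRingCat.ofHom (Θⱼ : A 4 K →+* A 4 K)) ≫ AffineCoordBlowup.chartImm hπ (succ_mem_centreVars hj)
      let Zc := vanishingIdeal (closureImage φⱼ ((AffineCoordBlowup.𝓘Λ 4 K
        (insert 0 (Fin.succ '' (S' : Set (Fin 4))))).support : Set (P 4 K)))
      let M' := ((⟨hypSheaf p s.F, [], p⟩ : MarkedIdeal (P 4 K)).transform π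
        (AffineCoordBlowup.𝓘Λ 4 K (insert 0 (Fin.succ '' (S : Set (Fin 4))))))
      (M'.ideal.comap φⱼ = hypSheaf p (CentreBlowup.step p S j b s).F ∧
        Zc.comap φⱼ = AffineCoordBlowup.𝓘Λ 4 K (insert 0 (Fin.succ '' (S' : Set (Fin 4)))) ∧
        Scheme.IsRegular Zc.subscheme ∧ (Zc.support : Set W) ⊆ M'.support ∧ HasSNCWith M'.boundary Zc) ∧
      ((Zc.support : Set W) ⊆ ⋃ (l : Fin 4) (hl : l ∈ S \ S'.erase j),
        ((AffineCoordBlowup.chartImm hπ (succ_mem_centreVars (Finset.mem_sdiff.mp hl).1)).opensRange : Set W)) ∧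
      ∀ (l : Fin 4) (hl : l ∈ S), l ∉ S' →
        ∃ (Θ : A 4 K ≃ₐ[K] A 4 K) (τ : MvPolynomial (Fin 4) K ≃ₐ[K] MvPolynomial (Fin 4) K) (g : MvPolynomial (Fin 4) K)
          (_ : IsIso (CommRingCat.ofHom (Θ : A 4 K →+* A 4 K))),
          Θ (X 0) = X 0 + rename Fin.succ g ∧ (∀ i : Fin 4, Θ (X i.succ) = rename Fin.succ (τ (X i))) ∧
          τ (X j) = X j ∧ τ (X l) = X l ∧ (∀ i ∈ S, i ≠ j → i ≠ l → τ (X i) = X i + C (b i) * X j) ∧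
          (∀ k ∉ S, τ (X k) = X k + C (b k)) ∧
          let φ := Spec.map (CommRingCat.ofHom (Θ : A 4 K →+* A 4 K)) ≫
            AffineCoordBlowup.chartImm hπ (succ_mem_centreVars hl)
          let Fl := g ^ p + τ (CentreBlowup.chartTransform p S l s.F)
          M'.ideal.comap φ = hypSheaf p Fl ∧
          Zc.comap φ = AffineCoordBlowup.𝓘Λ 4 K (insert 0 (Fin.succ '' ((insert l (S'.erase j) : Finset (Fin 4)) : Set (Fin 4)))) ∧
          Fl ≠ 0 ∧ HauserPerlega.IsClean p Fl ∧ (p : ℕ∞) ≤ CentreBlowup.ordAlong (insert l (S'.erase j)) Fl ∧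
          ((AffineCoordBlowup.𝓘Λ 4 K (insert 0 (Fin.succ '' (S : Set (Fin 4))))).comap π).comap φ =
            ofIdealTop (Ideal.span {(γ 4 K).symm (X l.succ + C 0)}) := by
  haveI : PerfectRing K p := PerfectRing.ofSurjective K p fun x => IsAlgClosed.exists_pow_nat_eq x hp.out.pos
  obtain ⟨θ, h, h0, hs, h1, -⟩ := exists_clean_translate_hyp_eq_step p hj hbj s hperm
  -- the re-centring of record of the `x_j`-chart: translation by `b`, then cleaning by `h`
  let Θⱼ : A 4 K ≃ₐ[K] A 4 K := (AffinePointBlowup.translateEquiv (Fin.cases 0 b)).trans θ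
  have hΘ0 : Θⱼ (X 0) = X 0 + rename Fin.succ h := by
    change θ (AffinePointBlowup.translateEquiv (Fin.cases 0 b) (X 0)) = _
    rw [AffinePointBlowup.translateEquiv_X, Fin.cases_zero, C_0, add_zero, h0]
  have hΘs : ∀ i : Fin 4, Θⱼ (X i.succ) = X i.succ + C (b i) := fun i => by
    change θ (AffinePointBlowup.translateEquiv (Fin.cases 0 b) (X i.succ)) = _
    rw [AffinePointBlowup.translateEquiv_X, Fin.cases_succ, map_add, hs]
    exact congrArg _ (θ.commutes (b i))
  have hread : Θⱼ (coordBlowupSubst K (insert 0 (Fin.succ '' (S : Set (Fin 4)))) j.succ (hyp p s.F)) =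
      X j.succ ^ p * hyp p (CentreBlowup.step p S j b s).F := by
    change θ (AffinePointBlowup.translateEquiv (Fin.cases 0 b) _) = _
    rw [← h1]
    rfl
  haveI hiso : IsIso (CommRingCat.ofHom (Θⱼ : A 4 K →+* A 4 K)) :=
    (inferInstance : IsIso Θⱼ.toRingEquiv.toCommRingCatIso.hom)
  refine ⟨Θⱼ, h, hiso, hΘ0, hΘs, ⟨?_, ?_, ?_, ?_, ?_⟩, ?_, fun l hl hlS' => ?_⟩
  · exact comap_chart_transform_ideal_of_reading hj hbj hΘ0 hΘs hπ hperm hread _ rfl rfl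
  · exact comap_globalCentre _ _
  · exact isRegular_globalCentre_of_reading hj hbj hΘ0 hΘs hπ hperm hread hperm'
  · exact support_globalCentre_subset_support_transform hj hbj hΘ0 hΘs hπ hperm hread hperm'
  · exact hasSNCWith_transform_boundary_globalCentre hj hbj hΘ0 hΘs hπ hperm hread hperm'
  · exact support_globalCentre_subset_iUnion_of_mem hj hjS' hbj hΘ0 hΘs hπ hperm hread hperm'
  · exact exists_shear_chart_reading_of_mem hj hjS' hbj hF hclean hΘ0 hΘs hπ hperm hread hperm' hl hlS'

/-! ## §4 Both cases in one signature -/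

/-- **THE ATLAS OF AN ESCAPING GLOBAL CENTRE — every `S'` (S3-N1, typ-2 side).** `K = K̄` of characteristic `p`; `s` a presented
state with `s.F ≠ 0` clean; `S ∋ j` Hironaka-permissible; `π : W → 𝔸⁵_K` ANY blowing up along `V(z, x_S)`; `b` with `b_j = 0`;
`S'` ANY next centre permissible for `step p S j b s`. With `Θⱼ` the re-centring of record, `Zc` the global centre and `M'` the
transform of `((z^p + s.F)·𝒪, [], p)`: the `x_j`-chart package of typ-2 g4 ∧ **`V(Zc) ⊆ ⋃_{l ∈ S ∖ (S' ∖ {j})} W[⊤, x_l]`** ∧ for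
every `l ∈ S ∖ S'`, `l ≠ j`, a cleaned shear re-centring of the `x_l`-chart reading `M'` as `(z^p + F_l)·𝒪` (`F_l ≠ 0` clean) and
`Zc` as `𝓘Λ_{T_l}` with `F_l` `T_l`-permissible, `T_l = insert l (S' ∖ {j})` if `j ∈ S'`, `T_l = S'` if `j ∉ S'`; `E₁` reads `x_l`. -/
theorem globalCentre_atlas_package [IsAlgClosed K] [DecidableEq K] (hj : j ∈ S) (hbj : b j = 0) (s : State K)
    (hF : s.F ≠ 0) (hclean : HauserPerlega.IsClean p s.F) (hperm : (p : ℕ∞) ≤ CentreBlowup.ordAlong S s.F)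
    (hπ : IsBlowup π (AffineCoordBlowup.𝓘Λ 4 K (insert 0 (Fin.succ '' (S : Set (Fin 4))))))
    (hperm' : (p : ℕ∞) ≤ CentreBlowup.ordAlong S' (CentreBlowup.step p S j b s).F) :
    ∃ (Θⱼ : A 4 K ≃ₐ[K] A 4 K) (h : MvPolynomial (Fin 4) K) (_ : IsIso (CommRingCat.ofHom (Θⱼ : A 4 K →+* A 4 K))),
      Θⱼ (X 0) = X 0 + rename Fin.succ h ∧ (∀ i : Fin 4, Θⱼ (X i.succ) = X i.succ + C (b i)) ∧
      let φⱼ := Spec.map (CommRingCat.ofHom (Θⱼ : A 4 K →+* A 4 K)) ≫ AffineCoordBlowup.chartImm hπ (succ_mem_centreVars hj)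
      let Zc := vanishingIdeal (closureImage φⱼ ((AffineCoordBlowup.𝓘Λ 4 K
        (insert 0 (Fin.succ '' (S' : Set (Fin 4))))).support : Set (P 4 K)))
      let M' := ((⟨hypSheaf p s.F, [], p⟩ : MarkedIdeal (P 4 K)).transform π
        (AffineCoordBlowup.𝓘Λ 4 K (insert 0 (Fin.succ '' (S : Set (Fin 4))))))
      (M'.ideal.comap φⱼ = hypSheaf p (CentreBlowup.step p S j b s).F ∧
        Zc.comap φⱼ = AffineCoordBlowup.𝓘Λ 4 K (insert 0 (Fin.succ '' (S' : Set (Fin 4)))) ∧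
        Scheme.IsRegular Zc.subscheme ∧ (Zc.support : Set W) ⊆ M'.support ∧ HasSNCWith M'.boundary Zc) ∧
      ((Zc.support : Set W) ⊆ ⋃ (l : Fin 4) (hl : l ∈ S \ S'.erase j),
        ((AffineCoordBlowup.chartImm hπ (succ_mem_centreVars (Finset.mem_sdiff.mp hl).1)).opensRange : Set W)) ∧
      ∀ (l : Fin 4) (hl : l ∈ S), l ∉ S' → j ≠ l →
        ∃ (Θ : A 4 K ≃ₐ[K] A 4 K) (τ : MvPolynomial (Fin 4) K ≃ₐ[K] MvPolynomial (Fin 4) K) (g : MvPolynomial (Fin 4) K)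
          (_ : IsIso (CommRingCat.ofHom (Θ : A 4 K →+* A 4 K))),
          Θ (X 0) = X 0 + rename Fin.succ g ∧ (∀ i : Fin 4, Θ (X i.succ) = rename Fin.succ (τ (X i))) ∧
          τ (X j) = X j ∧ τ (X l) = X l ∧ (∀ i ∈ S, i ≠ j → i ≠ l → τ (X i) = X i + C (b i) * X j) ∧
          (∀ k ∉ S, τ (X k) = X k + C (b k)) ∧
          let φ := Spec.map (CommRingCat.ofHom (Θ : A 4 K →+* A 4 K)) ≫
            AffineCoordBlowup.chartImm hπ (succ_mem_centreVars hl)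
          let Fl := g ^ p + τ (CentreBlowup.chartTransform p S l s.F)
          let Tl : Finset (Fin 4) := if j ∈ S' then insert l (S'.erase j) else S'
          M'.ideal.comap φ = hypSheaf p Fl ∧
          Zc.comap φ = AffineCoordBlowup.𝓘Λ 4 K (insert 0 (Fin.succ '' (Tl : Set (Fin 4)))) ∧
          Fl ≠ 0 ∧ HauserPerlega.IsClean p Fl ∧ (p : ℕ∞) ≤ CentreBlowup.ordAlong Tl Fl ∧
          ((AffineCoordBlowup.𝓘Λ 4 K (insert 0 (Fin.succ '' (S : Set (Fin 4))))).comap π).comap φ =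
            ofIdealTop (Ideal.span {(γ 4 K).symm (X l.succ + C 0)}) := by
  by_cases hjS' : j ∈ S'
  · obtain ⟨Θⱼ, h, hiso, hΘ0, hΘs, hpk, hcov, hch⟩ := globalCentre_atlas_package_of_mem hj hjS' hbj s hF hclean hperm hπ hperm'
    refine ⟨Θⱼ, h, hiso, hΘ0, hΘs, hpk, hcov, fun l hl hlS' _ => ?_⟩
    obtain ⟨Θ, τ, g, hisoΘ, h0, hτ, hτj, hτl, hτS, hτb, hrest⟩ := hch l hl hlS'
    refine ⟨Θ, τ, g, hisoΘ, h0, hτ, hτj, hτl, hτS, hτb, ?_⟩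
    simp only [if_pos hjS']
    exact hrest
  · obtain ⟨Θⱼ, h, hiso, hΘ0, hΘs, hpk, hcov, hch⟩ :=
      globalCentre_atlas_package_of_not_mem hj hjS' hbj s hF hclean hperm hπ hperm'
    refine ⟨Θⱼ, h, hiso, hΘ0, hΘs, hpk, ?_, fun l hl hlS' hjl => ?_⟩
    · intro w hw
      obtain ⟨l, hl, hwl⟩ := Set.mem_iUnion₂.mp (hcov hw)
      exact Set.mem_iUnion₂.mpr ⟨l, by rwa [Finset.erase_eq_of_notMem hjS'], hwl⟩
    · obtain ⟨Θ, τ, g, hisoΘ, h0, hτ, hτj, hτl, hτS, hτb, hrest⟩ := hch l hl hlS' hjl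
      refine ⟨Θ, τ, g, hisoΘ, h0, hτ, hτj, hτl, hτS, hτb, ?_⟩
      simp only [if_neg hjS']
      exact hrest

end ChartDictionary

end Summit.ResolutionOfSingularities.ResolutionOfSingularities.Theorems.PIDim4

end
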